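import Summits.BirchSwinnertonDyer.BirchSwinnertonDyer.Theorems.CyclotomicUntwistUntwistDatum
import Summits.BirchSwinnertonDyer.BirchSwinnertonDyer.Theorems.CyclotomicUntwistCoinvariantEigenvalue
import Literature.NumberTheory.EllipticCurves.NewformGaloisRepEulerFactors
import Literature.NumberTheory.EllipticCurves.EisensteinNewformLevelRaising
import Literature.FieldTheory.AlgClosed.PadicAlgClEquivComplex
import Mathlib.NumberTheory.LSeries.PrimesInAP
import HarnessLib

/-!
# Print layer (T) of crux child C1, file 3c: the UNIFORM ROOT LAW «a₃(g₀)² − a_w(W)·a₃(g₀) + 3 = 0» for every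
# newform with the packet of `f_W ⊗ η̄`, modulo Deligne (Hida Thm. 3.26 (1)) and Carayol (Thm. (A))

Cell `pub/bsd-wall` (D-0145 line `route-BirchSwinnertonDyer-CyclotomicUntwist`), seat `bsd-line-cycu-p1`
(K1/K2 LEAD lineage, gen 8). THEOREMS ONLY (no definition, no named fact, no `sorry`); helper toward the crux
child C1 = stmt-BirchSwinnertonDyer-27548. BSD is not proved by this file; no crux and no child of the route is
proved by it; the two named print facts `Hida2000_thm326_exists_galoisRep` (Deligne's `ℓ`-adic representations
of `Γ₁`-newforms) and `Carayol1986_eulerFactor` (Carayol 1986 Thm. (A), Euler-factor form) are HYPOTHESES, as is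
WILDNESS in Galois form (`hwild`, dischargeable from `ClassO6` through the Artin-conductor named fact — not here).

WHAT (`uniformRootLaw_of_print`, the interface agreed with cycu-p4 g12's `psUntwistedLFunctionAtThree_of_print_of_
uniformRootLaw`): on a principal-series row `W` (`ClassO6 W 3`, `v₃(Δ_min)` even, unit part `≡ 1 (mod 3)`) there
are a PRIMITIVE Dirichlet character `η` mod `9` and `α ∈ ℂ` with `α² − a_w(W)·α + 3 = 0` such that EVERY newform
`g₀ ∈ S₂(Γ₁(N₀))` carrying the packet of `f_W ⊗ η⁻¹` off finitely many primes (`a_p(g₀) = η⁻¹(p)·a_p(W)`,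
`ε_{g₀}(p) = η⁻¹(p)²`) has `a₃(g₀) = α`. Proof: `ℓ = 2`, `ι : ℚ̄₂ ≃ ℂ`, a frame `VQ` of `V₂(W)`
(`exists_framedGaloisRep_rationalTate`); the untwist datum `(ε = η⁻¹, ψ, τ, σ)` of file 3b; on
`ρ = (VQ ⊗ ℚ̄₂) ⊗ ψ` the inertia coinvariants at `𝔓 ∣ 3` are non-zero (file 1 §1) and `σ` has an eigenvalue
`λ` there, which is an eigenvalue of `ρ(σ)` (file 1 §2), i.e. a root of `X² − a_w X + 3`; `α := ι(λ)`. For a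
newform `g₀` with the packet: `3 ∣ N₀` (Dirichlet's theorem on primes `p ≡ 1 (N₀)`, `p ≡ 2 (9)` and `ε(2)² ≠ 1`),
so Carayol's coinvariant Euler factor of `ρ ≅ ρ_{g₀,2}` at `3` (engine
`map_reverse_charpoly_toInertiaCoinvariants_twist_eq`) is `1 − a₃(g₀)T`; file 1 §5 then forces the coinvariants
to be the LINE on which `σ` acts by `ι⁻¹(a₃(g₀))`, whence `ι⁻¹(a₃(g₀)) = λ`.

References: [cite: CarayolASENS1986, Thm. (A) (0.7) with (0.5), (0.8), pp. 410–411] · [cite: Hida2000, Thm. 3.26 (1)]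
· [cite: DeligneSerreASENS1974, Lemme 3.2] · [cite: SerreTate1968, §1–§2].
-/

set_option autoImplicit false
-- single-conjunct summit: `Summit.BirchSwinnertonDyer.BirchSwinnertonDyer.…` repeats the name by design
set_option linter.dupNamespace false

noncomputable section

open scoped NumberField
open Polynomial Module NumberField IsDedekindDomain Field CongruenceSubgroup Rat.HeightOneSpectrum
  Literature.NumberTheory.GaloisRepresentations Literature.NumberTheory.EllipticCurves
  Literature.NumberTheory.EllipticCurves.ModularForms
  Summit.BirchSwinnertonDyer.Rank1Residual.Additive
  Summit.BirchSwinnertonDyer.BirchSwinnertonDyer.Theorems.InertiaOverCyclotomicNine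
  Summit.BirchSwinnertonDyer.BirchSwinnertonDyer.Theorems.CoinvariantEigenvalue
  Summit.BirchSwinnertonDyer.BirchSwinnertonDyer.Theorems.NineCharacter

namespace Summit.BirchSwinnertonDyer.BirchSwinnertonDyer.Theorems.UniformRootLaw

variable (W : WeierstrassCurve ℚ) [W.IsElliptic] [W.IsGloballyMinimal]

set_option maxHeartbeats 1600000 in
/-- **The uniform root law (LAW (T)) modulo Deligne and Carayol.** On a principal-series row, granted Deligne's
representations for `Γ₁`-newforms (`Hida2000_thm326_exists_galoisRep`), Carayol's Thm. (A) in Euler-factor form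
(`Carayol1986_eulerFactor`) and wildness of `V₂(W)` at `3` in Galois form: there are a primitive `η` mod `9` and
`α ∈ ℂ` with `α² − a_w(W)·α + 3 = 0` such that every newform `g₀` carrying the packet of `f_W ⊗ η⁻¹` off finitely
many primes has `a₃(g₀) = α`. [cite: CarayolASENS1986, Thm. (A) (0.7) with (0.5), (0.8), pp. 410–411]
[cite: Hida2000, Thm. 3.26 (1)] [cite: DeligneSerreASENS1974, Lemme 3.2] -/
theorem uniformRootLaw_of_print (hD : Hida2000_thm326_exists_galoisRep) (hC : Carayol1986_eulerFactor)
    (hO6 : ClassO6 W 3) (hev : Even (padicValInt 3 W.minimalDiscriminantInt))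
    (hsq : W.minimalDiscriminantInt / 3 ^ padicValInt 3 W.minimalDiscriminantInt % 3 = 1)
    (hwild : ∃ (v : HeightOneSpectrum (𝓞 ℚ)) (𝔓 : Ideal (absIntegers (𝓞 ℚ) ℚ)), 𝔓 ∈ v.primesAbove ∧
      (3 : 𝓞 ℚ) ∈ v.asIdeal ∧ ∃ i ∈ 𝔓.inertia (absoluteGaloisGroup ℚ),
        (modNCyclotomicCharacter ℚ 9 i : ZMod 9) = 4 ∧ W.rationalGaloisRepTate 2 i ≠ 1) :
    ∃ η : DirichletCharacter ℂ 9, η.IsPrimitive ∧ ∃ α : ℂ,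
      α ^ 2 - (W.psUntwistedTrace : ℂ) * α + 3 = 0 ∧
      ∀ (T₀ : ℕ), T₀ ≠ 0 → ∀ {N₀ : ℕ} [NeZero N₀] (g₀ : CuspForm (Gamma1 N₀) 2), IsNewform1 g₀ →
        (∀ p : ℕ, p.Prime → ¬ p ∣ T₀ →
          cuspCoeff g₀ p = η⁻¹ (p : ZMod 9) * (W.LFunction p : ℂ) ∧
            (nebentypus g₀ (p : ZMod N₀) : ℂ) = η⁻¹ (p : ZMod 9) ^ 2) →
        cuspCoeff g₀ 3 = α := by
  classical
  obtain ⟨v, 𝔓, h𝔓, hv, hwild'⟩ := hwild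
  haveI : Fact (Nat.Prime 2) := ⟨Nat.prime_two⟩
  haveI := h𝔓.1
  haveI : NeZero ((9 : ℕ) : ℚ) := ⟨by norm_num⟩
  haveI := W.module_finite_rationalTateModule_holds 2
  obtain ⟨ι⟩ := PadicAlgCl.nonempty_ringEquiv_complex 2
  obtain ⟨VQ, eV, heV, hV⟩ := exists_framedGaloisRep_rationalTate W 2
  obtain ⟨ε, ψ, τ, σ, hε4, hψ, hτI, hσ, hχσ, hcyc, ⟨v₀, hv₀, hfix⟩, hchar⟩ :=
    UntwistDatum.exists_untwistDatum W hO6 hev hsq 2 (by norm_num) ι VQ eV heV hv h𝔓 hwild'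
  set ρ := FramedGaloisRep.toGaloisRep (((VQ.baseChange (algebraMap ℚ_[2] (PadicAlgCl 2))
    (continuous_algebraMap_padicAlgCl 2)).twist ψ)) with hρ
  -- `σ`, `τ` in the decomposition group
  have hσD : σ ∈ 𝔓.decompositionSubgroup (absoluteGaloisGroup ℚ) := hσ.mem_stabilizer
  have hτD : τ ∈ 𝔓.decompositionSubgroup (absoluteGaloisGroup ℚ) := Ideal.inertia_le_stabilizer 𝔓 hτI
  set σD : 𝔓.decompositionSubgroup (absoluteGaloisGroup ℚ) := ⟨σ, hσD⟩ with hσDdef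
  set τD : 𝔓.decompositionSubgroup (absoluteGaloisGroup ℚ) := ⟨τ, hτD⟩ with hτDdef
  have hτDI : τD ∈ 𝔓.inertia (𝔓.decompositionSubgroup (absoluteGaloisGroup ℚ)) := fun x => hτI x
  have hcycD : ∀ s ∈ 𝔓.inertia (𝔓.decompositionSubgroup (absoluteGaloisGroup ℚ)), ∃ j : ℕ,
      ρ (s : absoluteGaloisGroup ℚ) = ρ (τD : absoluteGaloisGroup ℚ) ^ j :=
    fun s hs => hcyc s (fun x => hs x)
  -- the eigenvalue `λ` of `σ` on the inertia coinvariants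
  have hpos : 0 < finrank (PadicAlgCl 2) (ρ.InertiaCoinvariants 𝔓) := by
    have h := finrank_coinvariants_pos_of_fixed (ρ.restrictDecomposition 𝔓)
      (𝔓.inertia (𝔓.decompositionSubgroup (absoluteGaloisGroup ℚ))) hτDI
      (fun s hs => by
        obtain ⟨j, hj⟩ := hcycD s hs
        exact ⟨j, by rw [ContinuousRep.restrictDecomposition_apply,
          ContinuousRep.restrictDecomposition_apply]; exact hj⟩)
      hv₀ (by rw [ContinuousRep.restrictDecomposition_apply]; exact hfix)
    exact h
  haveI : Nontrivial (ρ.InertiaCoinvariants 𝔓) := Module.nontrivial_of_finrank_pos (R := PadicAlgCl 2) hpos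
  obtain ⟨lam, hlam⟩ := Module.End.exists_eigenvalue (ρ.toInertiaCoinvariants 𝔓 σD)
  have hlamρ : Module.End.HasEigenvalue (ρ σ) lam := by
    have h := hasEigenvalue_of_hasEigenvalue_toCoinvariants (ρ.restrictDecomposition 𝔓)
      (𝔓.inertia (𝔓.decompositionSubgroup (absoluteGaloisGroup ℚ))) σD hlam
    rwa [ContinuousRep.restrictDecomposition_apply] at h
  have hlamroot : lam ^ 2 - ((W.psUntwistedTrace : ℤ) : PadicAlgCl 2) * lam + 3 = 0 := by
    have h := (Module.End.hasEigenvalue_iff_isRoot_charpoly _ lam).mp hlamρ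
    rw [hchar, Polynomial.IsRoot] at h
    simpa using h
  refine ⟨ε⁻¹, ?_, ι lam, ?_, ?_⟩
  · -- `η = ε⁻¹` is primitive: `η(4) = ε(4)⁻¹ ≠ 1`
    apply isPrimitive_of_apply_four_ne_one
    rw [MulChar.inv_apply_eq_inv']
    exact inv_ne_one.mpr hε4
  · have h := congrArg ι hlamroot
    simpa [map_ofNat] using h
  · intro T₀ hT₀ N₀ _ g₀ hg₀ hpk
    rw [inv_inv] at hpk
    -- Deligne's representation of `g₀`
    obtain ⟨ρg, hρg, hirr⟩ := hD g₀ le_rfl hg₀ 2 ι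
    -- the character `ψ` at the primes `q ∤ 9`
    have hψI : ∀ (v' : HeightOneSpectrum (𝓞 ℚ)), ¬ ((primesEquiv v' : Nat.Primes) : ℕ) ∣ 9 →
        ∀ 𝔓' ∈ v'.primesAbove, ∀ σ' ∈ 𝔓'.inertia (absoluteGaloisGroup ℚ), ψ σ' = 1 := by
      intro v' hv' 𝔓' h𝔓' σ' hσ'
      haveI := h𝔓'.1
      have hN := Rat.natCast_not_mem_of_mem_primesAbove_of_not_dvd h𝔓' hv'
      have h1 := modNCyclotomicCharacter_eq_one_of_mem_inertia (K := ℚ) (N := 9) hN hσ'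
      ext
      rw [hψ σ', h1, Units.val_one, MulChar.map_one, map_one, Units.val_one]
    have hψF : ∀ (v' : HeightOneSpectrum (𝓞 ℚ)), ¬ ((primesEquiv v' : Nat.Primes) : ℕ) ∣ 9 →
        ∀ 𝔓' ∈ v'.primesAbove, ∀ σ' : absoluteGaloisGroup ℚ, IsArithFrobAt (𝓞 ℚ) σ' 𝔓' →
          (ψ σ' : PadicAlgCl 2) = ι.symm (ε (((primesEquiv v' : Nat.Primes) : ℕ) : ZMod 9)) := by
      intro v' hv' 𝔓' h𝔓' σ' hσ'
      have hN := Rat.natCast_not_mem_of_mem_primesAbove_of_not_dvd h𝔓' hv'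
      rw [hψ σ', modNCyclotomicCharacter_eq_residueCard_of_isArithFrobAt h𝔓' hN hσ',
        FramedRep.residueCard_eq_coe_primesEquiv' v']
    -- `2 ∉ v`
    have h2v : (2 : 𝓞 ℚ) ∉ v.asIdeal := by
      intro h2
      apply v.isPrime.ne_top
      rw [Ideal.eq_top_iff_one]
      have h := v.asIdeal.sub_mem hv h2
      norm_num at h
      exact h
    -- Carayol's coinvariant Euler factor of `ρ ≅ ρ_{g₀}` at `3`
    have hengine := map_reverse_charpoly_toInertiaCoinvariants_twist_eq W 2 ι VQ hV 9
      (fun n => ε (n : ZMod 9)) ψ hψI hψF g₀ hg₀ hT₀ hpk ρg hρg hirr hC h2v h𝔓 σD hσ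
    have hp3 : ((primesEquiv v : Nat.Primes) : ℕ) = 3 := natGenerator_eq_three hv
    -- `3 ∣ N₀`, so the nebentypus of `g₀` vanishes at `3`
    have h3N : 3 ∣ N₀ := by
      by_contra h3
      have hcop : Nat.Coprime 9 N₀ := by
        rw [show (9 : ℕ) = 3 ^ 2 by norm_num]
        exact Nat.Coprime.pow_left 2 (Nat.prime_three.coprime_iff_not_dvd.mpr h3)
      haveI : NeZero (9 * N₀) := ⟨mul_ne_zero (by norm_num) (NeZero.ne N₀)⟩
      let e := ZMod.chineseRemainder hcop
      set a : ZMod (9 * N₀) := e.symm (2, 1) with ha_def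
      have ha : IsUnit a := by
        have h2u : IsUnit (2 : ZMod 9) := by decide
        exact (Prod.isUnit_iff.mpr ⟨h2u, isUnit_one⟩).map e.symm
      obtain ⟨p, hpT, hp, hpa⟩ := Nat.forall_exists_prime_gt_and_eq_mod ha T₀
      have hpT' : ¬ p ∣ T₀ := fun h => absurd hpT (not_lt.mpr (Nat.le_of_dvd (Nat.pos_of_ne_zero hT₀) h))
      -- `p ≡ 2 (mod 9)` and `p ≡ 1 (mod N₀)`
      have hep : e (p : ZMod (9 * N₀)) = ((p : ZMod 9), (p : ZMod N₀)) := by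
        rw [map_natCast]; rfl
      rw [hpa, ha_def, RingEquiv.apply_symm_apply] at hep
      have hp9 : (p : ZMod 9) = 2 := (congrArg Prod.fst hep).symm
      have hpN : (p : ZMod N₀) = 1 := (congrArg Prod.snd hep).symm
      obtain ⟨-, hneb_p⟩ := hpk p hp hpT'
      rw [hpN, hp9, MulChar.map_one] at hneb_p
      apply hε4
      rw [show (4 : ZMod 9) = 2 * 2 by norm_num, map_mul, ← sq, ← hneb_p]
    have hneb : nebentypus g₀ ((3 : ℕ) : ZMod N₀) = 0 := by
      apply MulChar.map_nonunit
      rw [ZMod.isUnit_iff_coprime, Nat.prime_three.coprime_iff_not_dvd]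
      exact fun h => h h3N
    rw [hp3] at hengine
    simp only [Nat.cast_ofNat] at hengine hneb
    rw [hneb, zero_mul, map_zero, zero_mul, add_zero] at hengine
    -- pull back along `ι`
    have hrev : (ρ.toInertiaCoinvariants 𝔓 σD).charpoly.reverse = 1 - C (ι.symm (cuspCoeff g₀ 3)) * X := by
      apply_fun Polynomial.map (ι.symm : ℂ →+* PadicAlgCl 2) at hengine
      rw [Polynomial.map_map, RingEquiv.symm_comp, Polynomial.map_id] at hengine
      rw [hengine]
      simp only [Polynomial.map_sub, Polynomial.map_one, Polynomial.map_mul, map_C, map_X,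
        RingEquiv.coe_toRingHom]
    -- file 1 §5: the coinvariants are a line on which `σ` acts by `ι⁻¹(a₃(g₀))`
    obtain ⟨-, hcharcoinv, -⟩ := isRoot_charpoly_of_charpoly_reverse_toInertiaCoinvariants_eq ρ 𝔓 hτDI hcycD
      hv₀ hfix σD (ι.symm (cuspCoeff g₀ 3)) hrev
    have hlam' : lam = ι.symm (cuspCoeff g₀ 3) := by
      have h := (Module.End.hasEigenvalue_iff_isRoot_charpoly _ lam).mp hlam
      rw [hcharcoinv, Polynomial.IsRoot, eval_sub, eval_X, eval_C, sub_eq_zero] at h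
      exact h
    rw [hlam', RingEquiv.apply_symm_apply]

end Summit.BirchSwinnertonDyer.BirchSwinnertonDyer.Theorems.UniformRootLaw

end
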